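import Mathlib
import HarnessLib

/-!
# Zero-mode action floor — integration of a divergence against a squared cut-off (lead c7, line
`zero-mode-floor-dilute-gas` of crux `NestedDissectionSea.EarlyCrosserLaw`, stmt-QuantumFields-13995)

Helpers for the registered stub `stub_floorAssembly`: on `ℝ⁴ = EuclideanSpace ℝ (Fin 4)`,
`∫ ∂_v φ = 0` for a compactly supported `C¹` function, and the "Bochner trick"
`∫ χ² (Σ_μ ∂_μ V_μ) = −2 ∫ χ Σ_μ (∂_μ χ) V_μ` for `C¹` fields `V_μ` and a smooth compactly supported
cut-off `χ` (integration by parts, no boundary terms).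
-/

noncomputable section

open scoped BigOperators ContDiff
open MeasureTheory

namespace Summit.QuantumFields.QCD.Cruxes.EarlyCrosserLaw.ZeroModeFloorDiluteGas

/-- A compactly supported `C¹` real function on `ℝ⁴` has `∫ ∂_v φ = 0` in every direction `v`. -/
theorem integral_fderiv_apply_eq_zero (φ : EuclideanSpace ℝ (Fin 4) → ℝ) (hφ : ContDiff ℝ 1 φ)
    (hsupp : HasCompactSupport φ) (v : EuclideanSpace ℝ (Fin 4)) :
    ∫ x, fderiv ℝ φ x v = 0 := by
  have hcont : Continuous fun x => fderiv ℝ φ x v :=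
    (hφ.continuous_fderiv one_ne_zero).clm_apply continuous_const
  have hsupp' : HasCompactSupport fun x => fderiv ℝ φ x v :=
    hsupp.fderiv_apply (𝕜 := ℝ) v
  have h1 : Integrable (fun x => fderiv ℝ (fun _ : EuclideanSpace ℝ (Fin 4) => (1 : ℝ)) x v * φ x) := by
    simp
  have h2 : Integrable (fun x => (fun _ : EuclideanSpace ℝ (Fin 4) => (1 : ℝ)) x * fderiv ℝ φ x v) := by
    simpa using hcont.integrable_of_hasCompactSupport hsupp'
  have h3 : Integrable (fun x => (fun _ : EuclideanSpace ℝ (Fin 4) => (1 : ℝ)) x * φ x) := by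
    simpa using hφ.continuous.integrable_of_hasCompactSupport hsupp
  have key := integral_mul_fderiv_eq_neg_fderiv_mul_of_integrable (μ := volume) h1 h2 h3
    (fun x _ => differentiableAt_const _) (fun x _ => (hφ.differentiable one_ne_zero x))
  simpa using key

/-- **Bochner trick.**  For `C¹` real fields `V_μ` on `ℝ⁴` and a smooth compactly supported cut-off `χ`:
`∫ χ² Σ_μ ∂_μ V_μ = −2 ∫ χ Σ_μ (∂_μ χ) V_μ` (`∂_μ = fderiv · (EuclideanSpace.single μ 1)`). -/
theorem integral_sq_mul_divergence (V : Fin 4 → EuclideanSpace ℝ (Fin 4) → ℝ) (hV : ∀ μ, ContDiff ℝ 1 (V μ))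
    (χ : EuclideanSpace ℝ (Fin 4) → ℝ) (hχ : ContDiff ℝ ∞ χ) (hχs : HasCompactSupport χ) :
    ∫ x, χ x ^ 2 * ∑ μ : Fin 4, fderiv ℝ (V μ) x (EuclideanSpace.single μ (1 : ℝ))
      = -2 * ∫ x, χ x * ∑ μ : Fin 4, fderiv ℝ χ x (EuclideanSpace.single μ (1 : ℝ)) * V μ x := by
  set e : Fin 4 → EuclideanSpace ℝ (Fin 4) := fun μ => EuclideanSpace.single μ (1 : ℝ) with he
  have hχ1 : ContDiff ℝ 1 χ := hχ.of_le (by exact_mod_cast le_top)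
  have hχ2 : ContDiff ℝ 1 fun x => χ x ^ 2 := hχ1.pow 2
  have hχ2s : HasCompactSupport fun x => χ x ^ 2 := by
    have : (fun x => χ x ^ 2) = fun x => χ x * χ x := funext fun x => sq _
    rw [this]
    exact hχs.mul_right
  -- derivative of χ²
  have hdχ2 : ∀ x μ, fderiv ℝ (fun x => χ x ^ 2) x (e μ) = 2 * χ x * fderiv ℝ χ x (e μ) := by
    intro x μ
    have hd : DifferentiableAt ℝ χ x := hχ1.differentiable one_ne_zero x
    rw [show (fun x => χ x ^ 2) = fun x => χ x * χ x from funext fun x => by ring]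
    rw [fderiv_fun_mul hd hd]
    simp only [_root_.add_apply, FunLike.coe_smul, Pi.smul_apply, smul_eq_mul]
    ring
  -- per-direction integration by parts
  have hμ : ∀ μ, ∫ x, χ x ^ 2 * fderiv ℝ (V μ) x (e μ) = -2 * ∫ x, χ x * (fderiv ℝ χ x (e μ) * V μ x) := by
    intro μ
    have hVc : Continuous fun x => fderiv ℝ (V μ) x (e μ) :=
      ((hV μ).continuous_fderiv one_ne_zero).clm_apply continuous_const
    have h1 : Integrable (fun x => fderiv ℝ (fun x => χ x ^ 2) x (e μ) * V μ x) := by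
      have hc : Continuous fun x => fderiv ℝ (fun x => χ x ^ 2) x (e μ) * V μ x :=
        ((hχ2.continuous_fderiv one_ne_zero).clm_apply continuous_const).mul (hV μ).continuous
      exact hc.integrable_of_hasCompactSupport ((hχ2s.fderiv_apply (𝕜 := ℝ) (e μ)).mul_right)
    have h2 : Integrable (fun x => χ x ^ 2 * fderiv ℝ (V μ) x (e μ)) :=
      ((hχ2.continuous).mul hVc).integrable_of_hasCompactSupport hχ2s.mul_right
    have h3 : Integrable (fun x => χ x ^ 2 * V μ x) :=
      ((hχ2.continuous).mul (hV μ).continuous).integrable_of_hasCompactSupport hχ2s.mul_right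
    have key := integral_mul_fderiv_eq_neg_fderiv_mul_of_integrable (μ := volume) h1 h2 h3
      (fun x _ => hχ2.differentiable one_ne_zero x) (fun x _ => (hV μ).differentiable one_ne_zero x)
    rw [key, ← integral_neg, ← integral_const_mul]
    refine integral_congr_ae (ae_of_all _ fun x => ?_)
    simp only [hdχ2]
    ring
  -- sum over directions
  have hint : ∀ μ, Integrable (fun x => χ x ^ 2 * fderiv ℝ (V μ) x (e μ)) := fun μ =>
    ((hχ2.continuous).mul (((hV μ).continuous_fderiv one_ne_zero).clm_apply continuous_const)).integrable_of_hasCompactSupport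
      hχ2s.mul_right
  have hint' : ∀ μ, Integrable (fun x => χ x * (fderiv ℝ χ x (e μ) * V μ x)) := fun μ =>
    (hχ.continuous.mul (((hχ1.continuous_fderiv one_ne_zero).clm_apply continuous_const).mul
      (hV μ).continuous)).integrable_of_hasCompactSupport hχs.mul_right
  calc ∫ x, χ x ^ 2 * ∑ μ : Fin 4, fderiv ℝ (V μ) x (e μ)
      = ∫ x, ∑ μ : Fin 4, χ x ^ 2 * fderiv ℝ (V μ) x (e μ) := by
        refine integral_congr_ae (ae_of_all _ fun x => ?_); simp only [Finset.mul_sum]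
    _ = ∑ μ : Fin 4, ∫ x, χ x ^ 2 * fderiv ℝ (V μ) x (e μ) := integral_finsetSum _ fun μ _ => hint μ
    _ = ∑ μ : Fin 4, (-2 * ∫ x, χ x * (fderiv ℝ χ x (e μ) * V μ x)) := Finset.sum_congr rfl fun μ _ => hμ μ
    _ = -2 * ∑ μ : Fin 4, ∫ x, χ x * (fderiv ℝ χ x (e μ) * V μ x) := by rw [Finset.mul_sum]
    _ = -2 * ∫ x, ∑ μ : Fin 4, χ x * (fderiv ℝ χ x (e μ) * V μ x) := by
        rw [integral_finsetSum _ fun μ _ => hint' μ]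
    _ = -2 * ∫ x, χ x * ∑ μ : Fin 4, fderiv ℝ χ x (e μ) * V μ x := by
        congr 1
        refine integral_congr_ae (ae_of_all _ fun x => ?_); simp only [Finset.mul_sum]

end Summit.QuantumFields.QCD.Cruxes.EarlyCrosserLaw.ZeroModeFloorDiluteGas

end
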